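import Mathlib.RingTheory.Smooth.Basic
import Mathlib.RingTheory.Unramified.Field
import Mathlib.RingTheory.Etale.Field
import Mathlib.RingTheory.Derivation.MapCoeffs
import Mathlib.FieldTheory.KummerPolynomial
import Mathlib.FieldTheory.IntermediateField.Adjoin.Algebra
import Mathlib.FieldTheory.Minpoly.Field
import Mathlib.FieldTheory.PurelyInseparable.Basic
import Mathlib.FieldTheory.SeparableClosure
import Mathlib.Algebra.CharP.Reduced
import Mathlib.Algebra.CharP.Lemmas
import Mathlib.Algebra.CharP.Algebra
import Mathlib.Order.Zorn
import Literature.NumberTheory.Transcendental.DerivationExtension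
import HarnessLib

/-!
# Formally smooth algebraic field extensions are separable (Matsumura, Thm. 26.9)

Topic: `Literature/FieldTheory/Separability`. For a field extension `L/K`, Matsumura
(*Commutative Ring Theory*, Thm. 26.9) proves: `L` is `0`-smooth (= formally smooth) over `K`
if and only if `L/K` is separable. This file PROVES the theorem for ALGEBRAIC extensions, where
"separable" is Mathlib's `Algebra.IsSeparable`:

* `formallySmooth_iff_isSeparable_of_isAlgebraic` — for `L/K` algebraic,
  `Algebra.FormallySmooth K L ↔ Algebra.IsSeparable K L`. The direction "⇐" is Mathlib's
  `Algebra.FormallyEtale.of_isSeparable`; the direction "⇒"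
  (`Algebra.IsSeparable.of_formallySmooth_of_isAlgebraic`) is proved here.

It discharges the named fact `Literature.AlgebraicGeometry.Resolution.Matsumura1987_26_9`
(`Literature/AlgebraicGeometry/Resolution/InseparableLocalUniformizationHeightStepTwo.lean`),
the dictionary between the two renderings of Temkin's "simple point" in the vendoring of
Temkin's inseparable local uniformization (see `InseparableLocalUniformizationMatsumura.lean`).

## Proof

"⇒": let `E` be the separable closure of `K` in `L`; `E/K` is formally unramified, so `L` is
formally smooth over `E` (Mathlib `Algebra.FormallySmooth.of_restrictScalars`), and `L/E` is
purely inseparable. If `L ≠ E`, pick `y ∈ L ∖ E` with `a = y^p ∈ E`; then `a ∉ E^p`.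

1. `exists_derivation_apply_eq_one_of_forall_pow_ne` (the `p`-basis theorem in its weakest
   form, Matsumura §26 / folklore): since `a ∉ E^p` there is a derivation `D` of `E` with
   `D a = 1`. Proof by Zorn's lemma on PARTIAL DERIVATIONS (`PartialDerivation`: a subfield
   `F ⊇ E^p` and a derivation on `F` killing `E^p`), which extend along `F ⊂ F(z)` with
   arbitrary value at `z ∉ F` because the minimal polynomial `X^p - z^p` of `z` over `F` has
   zero derivative and constant term killed by `D` (`PartialDerivation.extend`).
2. `Derivation.apply_eq_zero_of_formallySmooth` (the obstruction): since `L/E` is formally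
   smooth, `D` (with values in `L`) extends to a derivation `D'` of `L`
   (`Literature.NumberTheory.Transcendental.Derivation.exists_extension_of_formallySmooth`, `DerivationExtension.lean`: the map
   `L ⊗ Ω[E] → Ω[L]` is injective by the Jacobi–Zariski sequence); then
   `D a = D'(y^p) = p y^{p-1} D'(y) = 0`: contradiction.

## References

* H. Matsumura, *Commutative Ring Theory*, Cambridge Studies in Adv. Math. 8, CUP (1986/1989),
  §26 (separability, `p`-bases) and Thm. 26.9 ("If `K` is a separable field extension of a
  field `k`, then `K` is `0`-smooth, and conversely"; p. 222 of the held copy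
  `book:matsumura1986-commutative-ring-theory`).
* A. Grothendieck, EGA IV₁ (Publ. Math. IHÉS 20, 1964), Ch. 0, Thm. 19.6.1 (the same
  equivalence) and §21 (`p`-bases).
-/

noncomputable section

open Polynomial

namespace Literature.FieldTheory.Separability

universe u v

/-! ## Partial derivations and the `p`-basis theorem (weak form) -/


variable {E : Type u} [Field E] (p : ℕ)

/-- A **partial derivation** of a field `E` relative to the exponent `p` (in the application,
`p = char E` and `F ⊇ E^p`): a subfield `F` containing all `p`-th powers and a function
`D : E → E` which is additive and satisfies the Leibniz rule on `F` and kills all `p`-th powers.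
(Auxiliary structure for the Zorn argument producing derivations non-vanishing at a given
element outside `E^p`.) [folklore] -/
structure PartialDerivation where
  /-- the subfield on which `D` is a derivation -/
  F : Subfield E
  /-- the derivation, as a total function (values outside `F` are irrelevant) -/
  D : E → E
  pow_mem : ∀ x : E, x ^ p ∈ F
  apply_pow : ∀ x : E, D (x ^ p) = 0
  apply_add : ∀ x ∈ F, ∀ y ∈ F, D (x + y) = D x + D y
  apply_mul : ∀ x ∈ F, ∀ y ∈ F, D (x * y) = x * D y + y * D x

namespace PartialDerivation

variable {p}
variable (P : PartialDerivation (E := E) p)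

/-- `D 0 = 0`. [folklore] -/
theorem apply_zero : P.D 0 = 0 := by
  have h := P.apply_add 0 P.F.zero_mem 0 P.F.zero_mem
  simpa using h

/-- `D 1 = 0` (as `1 = 1 ^ p`). [folklore] -/
theorem apply_one : P.D 1 = 0 := by
  simpa using P.apply_pow 1

/-- `D` restricted to `F`, as a `ℤ`-derivation of the field `F` into `E`. [folklore] -/
def derivation : Derivation ℤ P.F E where
  toLinearMap :=
    ({ toFun := fun c => P.D c
       map_zero' := by simpa using P.apply_zero
       map_add' := fun x y => P.apply_add x x.2 y y.2 } : P.F →+ E).toIntLinearMap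
  map_one_eq_zero' := by
    change P.D ((1 : P.F) : E) = 0
    simpa using P.apply_one
  leibniz' x y := by
    change P.D ((x * y : P.F) : E) = (x : E) • P.D y + (y : E) • P.D x
    rw [Subfield.coe_mul, smul_eq_mul, smul_eq_mul]
    exact P.apply_mul x x.2 y y.2

/-- Unfolding `PartialDerivation.derivation`. [folklore] -/
@[simp] theorem derivation_apply (c : P.F) : P.derivation c = P.D c := rfl

/-- The structure map `F → E` is the inclusion. [folklore] -/
@[simp] theorem algebraMap_apply (c : P.F) : algebraMap P.F E c = c := rfl

/-! ### Extension along `F ⊂ F(z)` -/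

/-- `z ^ p` as an element of `F`. [folklore] -/
def cPow (z : E) : P.F := ⟨z ^ p, P.pow_mem z⟩

/-- Unfolding `cPow`. [folklore] -/
@[simp] theorem coe_cPow (z : E) : (P.cPow z : E) = z ^ p := rfl

/-- The polynomial `X ^ p - z ^ p ∈ F[X]` (for `z ∉ F` and `p = char E`, the minimal
polynomial of `z` over `F`). [folklore] -/
def minpolyZ (z : E) : (P.F)[X] := X ^ p - C (P.cPow z)

/-- `z` is a root of `X ^ p - z ^ p`. [folklore] -/
theorem aeval_minpolyZ (z : E) : aeval z (P.minpolyZ z) = 0 := by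
  simp [minpolyZ]

/-- The candidate extension of `D` to `F[z]` with value `w` at `z`, evaluated on a
representative `g ∈ F[X]`: `Φ(g) = (Dg)(z) + g'(z) · w` (`Dg` = `D` applied to the
coefficients). [folklore] -/
def phi (z w : E) (g : (P.F)[X]) : E :=
  PolynomialModule.eval z ((P.derivation.mapCoeffs g).map E LinearMap.id) +
    aeval z (derivative g) * w

/-- `Φ` is additive. [folklore] -/
theorem phi_add (z w : E) (g h : (P.F)[X]) :
    P.phi z w (g + h) = P.phi z w g + P.phi z w h := by
  simp only [phi, map_add, add_mul]
  abel

/-- `Φ` extends `D` on constants. [folklore] -/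
theorem phi_C (z w : E) (c : P.F) : P.phi z w (C c) = P.D c := by
  simp [phi]

/-- `Φ(X) = w`. [folklore] -/
theorem phi_X (z w : E) : P.phi z w X = w := by
  simp [phi]

/-- `Φ` satisfies the Leibniz rule along evaluation at `z`. [folklore] -/
theorem phi_mul (z w : E) (g h : (P.F)[X]) :
    P.phi z w (g * h) = aeval z g * P.phi z w h + aeval z h * P.phi z w g := by
  simp only [phi, Derivation.leibniz, map_add, PolynomialModule.map_smul,
    PolynomialModule.eval_smul, eval_map_algebraMap, smul_eq_mul, derivative_mul, map_mul]
  ring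

open scoped Classical in
/-- `repr z x` is the reduced representative `g ∈ F[X]` (reduced modulo `X ^ p - z ^ p`) with
`g(z) = x` when `x ∈ F[z]`, and `0` otherwise. [folklore] -/
def repr (z x : E) : (P.F)[X] :=
  if h : ∃ g : (P.F)[X], aeval z g = x then Classical.choose h %ₘ P.minpolyZ z else 0

/-- The subfield `F(z)`. [folklore] -/
def adjoinZ (z : E) : Subfield E := (IntermediateField.adjoin P.F {z}).toSubfield

section charP

variable [CharP E p]

/-- `Φ` kills `X ^ p - z ^ p` (its derivative is `p X^{p-1} = 0` and `D (z ^ p) = 0`).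
[folklore] -/
theorem phi_minpolyZ (z w : E) : P.phi z w (P.minpolyZ z) = 0 := by
  have h1 : P.derivation.mapCoeffs (P.minpolyZ z) = 0 := by
    rw [minpolyZ, map_sub, Derivation.leibniz_pow, Derivation.mapCoeffs_X, smul_zero, smul_zero,
      zero_sub, neg_eq_zero, Derivation.mapCoeffs_C, derivation_apply, coe_cPow, P.apply_pow]
    simp
  have h2 : aeval z (derivative (P.minpolyZ z)) = 0 := by
    simp [minpolyZ, derivative_X_pow]
  simp [phi, h1, h2]

/-- `Φ` only depends on the residue modulo `X ^ p - z ^ p`. [folklore] -/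
theorem phi_modByMonic (z w : E) (g : (P.F)[X]) :
    P.phi z w (g %ₘ P.minpolyZ z) = P.phi z w g := by
  conv_rhs => rw [← modByMonic_add_div g (P.minpolyZ z)]
  rw [phi_add, phi_mul, aeval_minpolyZ, phi_minpolyZ]
  ring

end charP

section prime

variable [Fact p.Prime]

/-- `X ^ p - z ^ p` is monic. [folklore] -/
theorem minpolyZ_monic (z : E) : (P.minpolyZ z).Monic :=
  monic_X_pow_sub_C _ (Fact.out : p.Prime).ne_zero

/-- `X ^ p - z ^ p` has degree `p`. [folklore] -/
theorem degree_minpolyZ (z : E) : (P.minpolyZ z).degree = p :=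
  degree_X_pow_sub_C (Fact.out : p.Prime).pos _

/-- `z` is integral over `F` (as `z ^ p ∈ F`). [folklore] -/
theorem isIntegralZ (z : E) : IsIntegral P.F z :=
  ⟨P.minpolyZ z, P.minpolyZ_monic z, by simpa [aeval_def] using P.aeval_minpolyZ z⟩

/-- `F(z) = F[z] = {g(z) : g ∈ F[X]}` since `z` is integral over `F`. [folklore] -/
theorem mem_adjoinZ_iff (z : E) {x : E} :
    x ∈ P.adjoinZ z ↔ ∃ g : (P.F)[X], aeval z g = x := by
  rw [adjoinZ, IntermediateField.mem_toSubfield, ← IntermediateField.mem_toSubalgebra,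
    IntermediateField.adjoin_simple_toSubalgebra_of_isAlgebraic (P.isIntegralZ z).isAlgebraic,
    Algebra.adjoin_singleton_eq_range_aeval, AlgHom.mem_range]

/-- `F ≤ F(z)`. [folklore] -/
theorem le_adjoinZ (z : E) : P.F ≤ P.adjoinZ z := fun c hc =>
  (P.mem_adjoinZ_iff z).mpr ⟨C ⟨c, hc⟩, by simp⟩

/-- `z ∈ F(z)`. [folklore] -/
theorem self_mem_adjoinZ (z : E) : z ∈ P.adjoinZ z :=
  (P.mem_adjoinZ_iff z).mpr ⟨X, by simp⟩

variable [CharP E p]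

/-- For `z ∉ F`, `X ^ p - z ^ p ∈ F[X]` is irreducible (`z ^ p` is not a `p`-th power in `F`,
by injectivity of Frobenius). [folklore] -/
theorem irreducible_minpolyZ {z : E} (hz : z ∉ P.F) : Irreducible (P.minpolyZ z) := by
  haveI : ExpChar E p := ExpChar.prime Fact.out
  refine X_pow_sub_C_irreducible_of_prime Fact.out fun b hb => hz ?_
  have hbz : (b : E) ^ p = z ^ p := by
    have := congrArg Subtype.val hb
    simpa using this
  have : (b : E) = z := frobenius_inj E p hbz
  exact this ▸ b.2

/-- For `z ∉ F`, the minimal polynomial of `z` over `F` is `X ^ p - z ^ p`. [folklore] -/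
theorem minpoly_eq {z : E} (hz : z ∉ P.F) : minpoly P.F z = P.minpolyZ z :=
  (minpoly.eq_of_irreducible_of_monic (P.irreducible_minpolyZ hz) (P.aeval_minpolyZ z)
    (P.minpolyZ_monic z)).symm

/-- The representative of `g(z)` is the remainder of `g` modulo `X ^ p - z ^ p`. [folklore] -/
theorem repr_aeval {z : E} (hz : z ∉ P.F) (g : (P.F)[X]) :
    P.repr z (aeval z g) = g %ₘ P.minpolyZ z := by
  have h : ∃ g' : (P.F)[X], aeval z g' = aeval z g := ⟨g, rfl⟩
  rw [repr, dif_pos h]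
  have hg' := Classical.choose_spec h
  have hdvd : P.minpolyZ z ∣ Classical.choose h - g := by
    rw [← P.minpoly_eq hz]
    exact minpoly.dvd _ _ (by simp [hg'])
  have := (modByMonic_eq_zero_iff_dvd (P.minpolyZ_monic z)).mpr hdvd
  rwa [sub_modByMonic, sub_eq_zero] at this

/-- `repr z x` evaluates to `x` on `F[z]`. [folklore] -/
theorem aeval_repr {z : E} (hz : z ∉ P.F) {x : E} (hx : ∃ g : (P.F)[X], aeval z g = x) :
    aeval z (P.repr z x) = x := by
  obtain ⟨g, rfl⟩ := hx
  rw [P.repr_aeval hz, aeval_modByMonic_eq_self_of_root (P.aeval_minpolyZ z)]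

/-- The representative of a constant is that constant. [folklore] -/
theorem repr_C {z : E} (hz : z ∉ P.F) (c : P.F) : P.repr z (c : E) = C c := by
  have : ((c : E)) = aeval z (C c) := by simp
  rw [this, P.repr_aeval hz, modByMonic_eq_self_iff (P.minpolyZ_monic z), degree_minpolyZ]
  exact degree_C_le.trans_lt (by exact_mod_cast (Fact.out : p.Prime).pos)

/-- The representative of `z` is `X`. [folklore] -/
theorem repr_self {z : E} (hz : z ∉ P.F) : P.repr z z = X := by
  rw [show P.repr z z = P.repr z (aeval z (X : (P.F)[X])) by rw [aeval_X], P.repr_aeval hz,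
    modByMonic_eq_self_iff (P.minpolyZ_monic z), degree_minpolyZ, degree_X]
  exact_mod_cast (Fact.out : p.Prime).one_lt

/-- **Extension of a partial derivation by a `p`-th root**: if `z ∉ F` (so `z ^ p ∈ F` and
`X ^ p - z ^ p` is the minimal polynomial of `z`), then `D` extends to `F(z)` with any prescribed
value `w` at `z`, by `D'(g(z)) = (Dg)(z) + g'(z) w` for `g ∈ F[X]`. [folklore] -/
def extend {z : E} (hz : z ∉ P.F) (w : E) : PartialDerivation (E := E) p where
  F := P.adjoinZ z
  D x := P.phi z w (P.repr z x)
  pow_mem x := P.le_adjoinZ z (P.pow_mem x)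
  apply_pow x := by
    have : x ^ p = ((P.cPow x : P.F) : E) := rfl
    rw [this, P.repr_C hz, phi_C, coe_cPow, P.apply_pow]
  apply_add x hx y hy := by
    obtain ⟨g, rfl⟩ := (P.mem_adjoinZ_iff z).mp hx
    obtain ⟨h, rfl⟩ := (P.mem_adjoinZ_iff z).mp hy
    rw [← map_add, P.repr_aeval hz, P.repr_aeval hz, P.repr_aeval hz, add_modByMonic, phi_add]
  apply_mul x hx y hy := by
    have hx' := (P.mem_adjoinZ_iff z).mp hx
    have hy' := (P.mem_adjoinZ_iff z).mp hy
    have ex : x = aeval z (P.repr z x) := (P.aeval_repr hz hx').symm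
    have ey : y = aeval z (P.repr z y) := (P.aeval_repr hz hy').symm
    have exy : x * y = aeval z (P.repr z x * P.repr z y) := by rw [map_mul, ← ex, ← ey]
    conv_lhs => rw [exy, P.repr_aeval hz, phi_modByMonic, phi_mul, ← ex, ← ey]

/-- The extension enlarges the domain. [folklore] -/
theorem le_extend_F {z : E} (hz : z ∉ P.F) (w : E) : P.F ≤ (P.extend hz w).F :=
  P.le_adjoinZ z

/-- `z` lies in the domain of the extension. [folklore] -/
theorem mem_extend_F {z : E} (hz : z ∉ P.F) (w : E) : z ∈ (P.extend hz w).F :=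
  P.self_mem_adjoinZ z

/-- The extension agrees with `D` on `F`. [folklore] -/
theorem extend_apply_of_mem {z : E} (hz : z ∉ P.F) (w : E) {x : E} (hx : x ∈ P.F) :
    (P.extend hz w).D x = P.D x := by
  change P.phi z w (P.repr z x) = P.D x
  have : x = ((⟨x, hx⟩ : P.F) : E) := rfl
  rw [this, P.repr_C hz, phi_C]

/-- The extension takes the prescribed value `w` at `z`. [folklore] -/
theorem extend_apply_self {z : E} (hz : z ∉ P.F) (w : E) : (P.extend hz w).D z = w := by
  change P.phi z w (P.repr z z) = w
  rw [P.repr_self hz, phi_X]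

end prime

/-! ### The order on partial derivations and Zorn's lemma -/

/-- Partial derivations are (pre)ordered by extension: `P ≤ Q` iff `P.F ≤ Q.F` and `Q.D`
agrees with `P.D` on `P.F`. [folklore] -/
instance : Preorder (PartialDerivation (E := E) p) where
  le P Q := P.F ≤ Q.F ∧ ∀ x ∈ P.F, Q.D x = P.D x
  le_refl P := ⟨le_rfl, fun _ _ => rfl⟩
  le_trans P Q R hPQ hQR :=
    ⟨hPQ.1.trans hQR.1, fun x hx => (hQR.2 x (hPQ.1 hx)).trans (hPQ.2 x hx)⟩

/-- Unfolding the order on partial derivations. [folklore] -/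
theorem le_def {P Q : PartialDerivation (E := E) p} :
    P ≤ Q ↔ P.F ≤ Q.F ∧ ∀ x ∈ P.F, Q.D x = P.D x := Iff.rfl

/-- `P ≤ P.extend hz w`. [folklore] -/
theorem le_extend [Fact p.Prime] [CharP E p] {z : E} (hz : z ∉ P.F) (w : E) :
    P ≤ P.extend hz w :=
  ⟨P.le_extend_F hz w, fun _ hx => P.extend_apply_of_mem hz w hx⟩

/-- Every nonempty chain of partial derivations has an upper bound (the union). [folklore] -/
theorem exists_upperBound (c : Set (PartialDerivation (E := E) p)) (hc : IsChain (· ≤ ·) c)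
    (hne : c.Nonempty) : ∃ ub : PartialDerivation (E := E) p, ∀ P ∈ c, P ≤ ub := by
  classical
  obtain ⟨P₀, hP₀⟩ := hne
  haveI : Nonempty c := ⟨⟨P₀, hP₀⟩⟩
  let S : c → Subfield E := fun Q => Q.1.F
  have hdir : Directed (· ≤ ·) S := by
    intro Q R
    rcases hc.total Q.2 R.2 with h | h
    · exact ⟨R, h.1, le_rfl⟩
    · exact ⟨Q, le_rfl, h.1⟩
  let Fub : Subfield E := ⨆ Q : c, S Q
  have hmem : ∀ {x : E}, x ∈ Fub ↔ ∃ Q : c, x ∈ Q.1.F := fun {x} =>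
    Subfield.mem_iSup_of_directed hdir
  let Dub : E → E := fun x => if h : ∃ Q : c, x ∈ Q.1.F then (Classical.choose h).1.D x else 0
  -- `Dub` agrees with `Q.D` on `Q.F` for every `Q ∈ c`
  have hagree : ∀ Q : c, ∀ x ∈ Q.1.F, Dub x = Q.1.D x := by
    intro Q x hx
    have h : ∃ Q : c, x ∈ Q.1.F := ⟨Q, hx⟩
    simp only [Dub, dif_pos h]
    rcases hc.total (Classical.choose h).2 Q.2 with h' | h'
    · exact (h'.2 x (Classical.choose_spec h)).symm ▸ rfl
    · exact h'.2 x hx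
  -- two elements of `Fub` lie in a common `Q.F`
  have hcommon : ∀ x ∈ Fub, ∀ y ∈ Fub, ∃ Q : c, x ∈ Q.1.F ∧ y ∈ Q.1.F := by
    intro x hx y hy
    obtain ⟨Q, hQ⟩ := hmem.mp hx
    obtain ⟨R, hR⟩ := hmem.mp hy
    obtain ⟨T, hQT, hRT⟩ := hdir Q R
    exact ⟨T, hQT hQ, hRT hR⟩
  refine ⟨{ F := Fub
            D := Dub
            pow_mem := fun x => hmem.mpr ⟨⟨P₀, hP₀⟩, P₀.pow_mem x⟩
            apply_pow := fun x => by
              rw [hagree ⟨P₀, hP₀⟩ _ (P₀.pow_mem x), P₀.apply_pow]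
            apply_add := fun x hx y hy => by
              obtain ⟨Q, hxQ, hyQ⟩ := hcommon x hx y hy
              rw [hagree Q x hxQ, hagree Q y hyQ, hagree Q _ (Q.1.F.add_mem hxQ hyQ),
                Q.1.apply_add x hxQ y hyQ]
            apply_mul := fun x hx y hy => by
              obtain ⟨Q, hxQ, hyQ⟩ := hcommon x hx y hy
              rw [hagree Q x hxQ, hagree Q y hyQ, hagree Q _ (Q.1.F.mul_mem hxQ hyQ),
                Q.1.apply_mul x hxQ y hyQ] }, fun Q hQ => ⟨?_, fun x hx => ?_⟩⟩
  · exact le_iSup S ⟨Q, hQ⟩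
  · exact hagree ⟨Q, hQ⟩ x hx

/-- A partial derivation defined on all of `E` is a derivation. [folklore] -/
def toDerivation (hP : P.F = ⊤) : Derivation ℤ E E where
  toLinearMap :=
    ({ toFun := P.D
       map_zero' := P.apply_zero
       map_add' := fun x y => P.apply_add x (hP ▸ Subfield.mem_top x) y
         (hP ▸ Subfield.mem_top y) } : E →+ E).toIntLinearMap
  map_one_eq_zero' := P.apply_one
  leibniz' x y := by
    change P.D (x * y) = x • P.D y + y • P.D x
    rw [smul_eq_mul, smul_eq_mul]
    exact P.apply_mul x (hP ▸ Subfield.mem_top x) y (hP ▸ Subfield.mem_top y)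

/-- Unfolding `toDerivation`. [folklore] -/
@[simp] theorem toDerivation_apply (hP : P.F = ⊤) (x : E) : P.toDerivation hP x = P.D x := rfl

variable (p) in
/-- The zero partial derivation on `E^p`. [folklore] -/
def frobeniusRange [Fact p.Prime] [CharP E p] : PartialDerivation (E := E) p where
  F := (frobenius E p).fieldRange
  D := 0
  pow_mem x := RingHom.mem_fieldRange.mpr ⟨x, frobenius_def ..⟩
  apply_pow _ := rfl
  apply_add := by simp
  apply_mul := by simp

end PartialDerivation

/-- **Derivations detect `p`-th powers** (the `p`-basis theorem in its weakest form): in a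
field `E` of characteristic `p`, if `a` is not a `p`-th power then some derivation of `E` does
not vanish at `a` (in fact takes the value `1`). Proof: Zorn's lemma on partial derivations
(derivations on subfields `F ⊇ E^p(a)` with `D a = 1`), using that such a derivation extends
along `F ⊂ F(z)` for `z ∉ F` since the minimal polynomial `X^p - z^p` of `z` has zero
derivative and coefficients killed by `D`. [folklore] -/
theorem exists_derivation_apply_eq_one_of_forall_pow_ne [Fact p.Prime] [CharP E p] (a : E)
    (ha : ∀ b : E, b ^ p ≠ a) :
    ∃ D : Derivation ℤ E E, D a = 1 := by
  classical
  let P₀ := PartialDerivation.frobeniusRange (E := E) p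
  have ha₀ : a ∉ P₀.F := by
    rintro ⟨b, hb⟩
    exact ha b (by simpa [frobenius_def] using hb)
  let P₁ := P₀.extend ha₀ 1
  let S : Set (PartialDerivation (E := E) p) := {P | a ∈ P.F ∧ P.D a = 1}
  have hP₁ : P₁ ∈ S := ⟨P₀.mem_extend_F ha₀ 1, P₀.extend_apply_self ha₀ 1⟩
  obtain ⟨M, -, hM⟩ := zorn_le_nonempty₀ S (fun c hcS hc Q hQ => by
    obtain ⟨ub, hub⟩ := PartialDerivation.exists_upperBound c hc ⟨Q, hQ⟩
    refine ⟨ub, ⟨(hub Q hQ).1 (hcS hQ).1, ?_⟩, hub⟩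
    rw [(hub Q hQ).2 a (hcS hQ).1]
    exact (hcS hQ).2) P₁ hP₁
  -- a maximal partial derivation is defined everywhere
  have hMtop : M.F = ⊤ := by
    by_contra htop
    obtain ⟨z, hz⟩ : ∃ z : E, z ∉ M.F := by
      by_contra h
      push Not at h
      exact htop (eq_top_iff.mpr fun z _ => h z)
    have hle : M ≤ M.extend hz 0 := M.le_extend hz 0
    have hS : M.extend hz 0 ∈ S :=
      ⟨hle.1 hM.1.1, by rw [hle.2 a hM.1.1]; exact hM.1.2⟩
    have hge : M.extend hz 0 ≤ M := hM.2 hS hle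
    exact hz (hge.1 (M.mem_extend_F hz 0))
  exact ⟨M.toDerivation hMtop, by rw [PartialDerivation.toDerivation_apply]; exact hM.1.2⟩

/-! ## Derivations obstruct formal smoothness of `p`-th root extensions -/

/-- **Derivations obstruct formal smoothness of `p`-th root extensions.** If `L/E` is a
formally smooth extension of fields with `CharP L p` (any `p : ℕ`; for `p = 0` the hypothesis
reads `a = 1`) and `a ∈ E` has a `p`-th root `y` in `L`, then every derivation `D` of `E` into
`L` kills `a`: `D` extends to a derivation `D'` of `L` (`Derivation.exists_extension_of_
formallySmooth`), and `D a = D' (y ^ p) = p y^{p-1} D' y = 0`. [folklore] -/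
theorem Derivation.apply_eq_zero_of_formallySmooth {E L : Type*} [Field E] [Field L]
    [Algebra E L] [Algebra.FormallySmooth E L] (p : ℕ) [CharP L p] (D : Derivation ℤ E L)
    {a : E} {y : L} (hy : y ^ p = algebraMap E L a) : D a = 0 := by
  obtain ⟨D', hD'⟩ :=
    Literature.NumberTheory.Transcendental.Derivation.exists_extension_of_formallySmooth (R := ℤ) (S := E) (T := L) (M := L) D
  rw [← hD', ← hy, Derivation.leibniz_pow, nsmul_eq_mul, CharP.cast_eq_zero, zero_mul]

/-! ## Formally smooth algebraic extensions are separable -/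

section separable

variable (K : Type u) (L : Type v) [Field K] [Field L] [Algebra K L]

/-- A purely inseparable, formally smooth field extension is trivial. [folklore] -/
theorem surjective_algebraMap_of_formallySmooth_of_isPurelyInseparable
    [IsPurelyInseparable K L] [Algebra.FormallySmooth K L] :
    Function.Surjective (algebraMap K L) := by
  classical
  obtain ⟨q, hq⟩ := ExpChar.exists K
  intro x
  have hex : ∃ n : ℕ, x ^ q ^ n ∈ (algebraMap K L).range := IsPurelyInseparable.pow_mem K q x
  -- the least such `n` is `0`
  rcases hm : Nat.find hex with _ | k
  · have h0 := Nat.find_spec hex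
    rw [hm, pow_zero, pow_one] at h0
    exact h0
  · exfalso
    have hk : x ^ q ^ (k + 1) ∈ (algebraMap K L).range := by
      have := Nat.find_spec hex
      rwa [hm] at this
    have hk' : x ^ q ^ k ∉ (algebraMap K L).range := Nat.find_min hex (by rw [hm]; omega)
    obtain ⟨a, ha⟩ := hk
    set y : L := x ^ q ^ k with hy
    have hya : y ^ q = algebraMap K L a := by rw [ha, hy, ← pow_mul, ← pow_succ]
    rcases hq with _ | ⟨hprime⟩
    · -- exponential characteristic `1`: `y = y ^ 1 ∈ K`
      exact hk' ⟨a, by simpa using hya.symm⟩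
    · haveI : Fact q.Prime := ⟨hprime⟩
      haveI : CharP L q := charP_of_injective_algebraMap (algebraMap K L).injective q
      haveI : ExpChar L q := ExpChar.prime hprime
      -- `a` is not a `q`-th power in `K`
      have ha' : ∀ b : K, b ^ q ≠ a := by
        intro b hb
        apply hk'
        refine ⟨b, ?_⟩
        have : (algebraMap K L b) ^ q = y ^ q := by rw [← map_pow, hb, hya]
        exact frobenius_inj L q this
      obtain ⟨D, hD⟩ := exists_derivation_apply_eq_one_of_forall_pow_ne q a ha'
      -- push `D` forward to a derivation with values in `L`
      let D' : Derivation ℤ K L :=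
        { toLinearMap := ((algebraMap K L : K →+ L).comp
            (D.toLinearMap.toAddMonoidHom)).toIntLinearMap
          map_one_eq_zero' := by simp
          leibniz' := fun b c => by
            change algebraMap K L (D (b * c)) =
              b • algebraMap K L (D c) + c • algebraMap K L (D b)
            simp only [Derivation.leibniz, smul_eq_mul, map_add, map_mul, Algebra.smul_def] }
      have hD' : D' a = algebraMap K L (D a) := rfl
      have h0 := Derivation.apply_eq_zero_of_formallySmooth q D' hya
      rw [hD', hD, map_one] at h0
      exact one_ne_zero h0

/-- **Formally smooth algebraic extensions are separable** (Matsumura, *Commutative Ring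
Theory*, Thm. 26.9, direction "`0`-smooth ⇒ separable", algebraic case).
[cite: Matsumura1987, Thm. 26.9] -/
theorem Algebra.IsSeparable.of_formallySmooth_of_isAlgebraic [Algebra.IsAlgebraic K L]
    [Algebra.FormallySmooth K L] : Algebra.IsSeparable K L := by
  let E := separableClosure K L
  haveI : Algebra.FormallyUnramified K E := Algebra.FormallyUnramified.of_isSeparable K E
  haveI : Algebra.FormallySmooth E L := Algebra.FormallySmooth.of_restrictScalars K E L
  have hsurj := surjective_algebraMap_of_formallySmooth_of_isPurelyInseparable E L
  rw [← separableClosure.eq_top_iff, eq_top_iff]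
  intro x _
  obtain ⟨e, rfl⟩ := hsurj x
  exact e.2

/-- **Matsumura's Theorem 26.9 for algebraic extensions**: an algebraic field extension `L/K`
is formally smooth (`0`-smooth) if and only if it is separable. "⇐" is Mathlib's
`Algebra.FormallyEtale.of_isSeparable`. [cite: Matsumura1987, Thm. 26.9] -/
theorem formallySmooth_iff_isSeparable_of_isAlgebraic [Algebra.IsAlgebraic K L] :
    Algebra.FormallySmooth K L ↔ Algebra.IsSeparable K L :=
  ⟨fun _ => Algebra.IsSeparable.of_formallySmooth_of_isAlgebraic K L,
    fun _ => haveI := Algebra.FormallyEtale.of_isSeparable K L; inferInstance⟩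

end separable

end Literature.FieldTheory.Separability
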